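import Summits.HodgeConjecture.HodgeConjecture.Cruxes.BlochSeedDiscOne.FinCheck

/-!
# SignedTestForms — SIGN-AWARE TEST FORMS of the letter model: the pairing identity, the MARGINAL ROW SCHEMA, and the TWO-RING LAW (v1.1)

Crux workfile of `BlochSeedDiscOne` (stmt-HodgeConjecture-18881), lens «strengthen» (plan-lens-HodgeAV-strengthen g12, MEMO-18). Evidence-grade kernel
facts about the LETTER MODEL of `DepthBoundA4` ∕ `FinCheck`; nothing here is a floor, a design, a sheaf or a SEED, and nothing is proved toward HC ∕ HC_CM ∕
HC_AV ∕ 18881 ∕ H2.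

THE FRAME (pen, MEMO-18 §1). For a coweight `λ : Word → ℤ[i]` put `φ_λ(c) := Σ_w λ_w · cellCoef c w` (the TEST FUNCTION of `λ` on cells). The PAIRING
IDENTITY `Σ_w λ_w · T(w) = Σ_{c ∈ U} (gN c − gP c) · φ_λ(c)` (`pairing_eq_sum_testFn`, pure re-summation) is the common parent of MEMO-14's sign-BLIND test
forms (`CoveringLaw.testForm_mu`: `φ_λ ≡ 0` on the support) and of the sign-AWARE ones: if `λ` is BLIND to the clean subspace (it annihilates every
(A1)-clean tensor with `T(eeee) = T(ēēēē) = 0`, i.e. its e-free part has zero sum on every degree) and `λ(ēēēē) = 0`, then for every (A1) assignment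
`λ(eeee) · μ = Σ_N gN · φ_λ − Σ_P gP · φ_λ`; so `Re φ_λ ≥ 0` on the N-support and `≤ 0` on the P-support forces `Re(λ(eeee) · μ) ≥ 0`, with equality iff
`Re φ_λ` vanishes on the support. With `λ(eeee) = 0` such a `λ` is a SEPARATOR: the coloured support carries no (A1) assignment with positive masses
unless `Re φ_λ ≡ 0` on it. By Stiemke's alternative (LP duality for strict positivity) a coloured support carries a strictly positive (A1) assignment iff
it has NO separator — so «every (A4)-closed coloured support with ≤ s cells is separable or μ-null» is a REFORMULATION of the sparse floor statements
(`IntegralityGap.SparseNonex`), not a strengthening; the restricted separator FAMILIES are the candidate letter calculi. This file types the first and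
simplest family, the LEVEL SEPARATORS (`λ` supported on e-free words; `φ_λ` sees only the PROFILES `(a, n)` of the letters), in its first instance:

THE TWO-RING LAW (§2, `twoRing_law`; generalises the mechanism of `DepthBoundA4.ringsEmpty_colevel_two` step (3)–(4)). If every N-support cell of an
(A1) assignment has all four letters of one profile `(a_N, n_N)` and every P-support cell all four letters of one profile `(a_P, n_P)`, with
`a_N² ≠ a_P²` and `b_P := a_P² − n_P ≠ 0`, then the P-side is EMPTY; if moreover `b_N := a_N² − n_N ≠ 0` the N-side is empty too. Proof: the two
degree-2 e-free words `hh11`, `pt111` give `b_N·ΣN = b_P·ΣP`, the two degree-4 words `hhhh`, `pt h h 1` give `a_N²·b_N·ΣN = a_P²·b_P·ΣP`, whence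
`(a_N² − a_P²)·b_P·ΣP = 0`. The explicit separators: `λ_P := (δ_hhhh − δ_(pt h h 1)) − a_N²·(δ_hh11 − δ_pt111)` has `φ ≡ 0` on the N-cells and
`φ = (a_P² − a_N²)·b_P < 0` on the P-cells (P lies below N), `λ_N := (δ_hhhh − δ_(pt h h 1)) − a_P²·(δ_hh11 − δ_pt111)` has `φ = (a_N² − a_P²)·b_N > 0`
on N and `≡ 0` on P — both blind with `λ(eeee) = λ(ēēēē) = 0` (`separator_excludes`); the kernel proof below runs the two linear equations directly. INSTANCE
(MEMO-18 §2, EXPERIMENT 1 of the g12 sign-in): both 97-cell SYNTHESIS-TRIPLE supports of MEMO-14 §4 (`CoveringLaw`: the Pythagorean `(7;±3,±4)`-ring over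
companions `(4;±5,±5)`, profiles `(7,24)` ∕ `(4,−34)`; the hub-neighbour ring `(13;±1,0),(13;0,±1)` over `(10;±2,±2)`, profiles `(13,168)` ∕ `(10,92)`)
are two-ring supports, so they carry NO (A1) assignment with non-negative masses other than zero (`twoRing_pythagorean`, `twoRing_hub`): the signed seeds
of MEMO-14 (`¬ AllRigid 14 97`) are invisible to positivity, and `SparseNonex 14 97 …` is untouched by them.

CONTENTS: §1 `testFn`, `pairing_eq_sum_testFn`, `signed_pairing_nonneg`; §1.1 `Blind`, `pairing_of_A1`, **`signedTestForm`**, `separator_excludes`; §1.2 MARGINAL ROW SCHEMA `OnA11`, `marg`, `row_regroup`, **`marginalRow_sound`**, `marginalRow_sound_blind`, `one_le_marg_of_pos`, `sum_marg_eq`; §2 `PurePair`, the words `wHHHH`, `wPTHH` (+ `DepthBoundA4.wHH ∕ wPT`), `cellCoef` on profile-pure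
cells, `sumN_eval`, **`twoRing_law`** (function form over any finite `U`), `twoRing_design` (list-design form via `FinCheck.T_eq_sum`), the two
instances. Typist: plan-lens-HodgeAV-strengthen g12 (single writer). -/

set_option linter.dupNamespace false
set_option autoImplicit false

namespace Summit.HodgeConjecture.HodgeConjecture.Cruxes.BlochSeedDiscOne.SignedTestForms

open Summit.HodgeConjecture.HodgeConjecture.Cruxes.BlochSeedDiscOne.DepthBoundA4
open Summit.HodgeConjecture.HodgeConjecture.Cruxes.BlochSeedDiscOne.FinCheck
open Finset

/-! ## §1 the pairing identity -/

/-- the TEST FUNCTION of a coweight `λ` (finitely supported on the `5⁴` words: we sum over all of them). -/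
def testFn (lam : Word → GaussianInt) (c : Cell) : GaussianInt := ∑ w : Word, lam w * cellCoef c w

/-- **PAIRING IDENTITY**: `Σ_w λ_w · T(w) = Σ_{c ∈ U} (gN c − gP c) · φ_λ(c)`. -/
theorem pairing_eq_sum_testFn (U : Finset Cell) (gN gP : Cell → ℕ) (lam : Word → GaussianInt) :
    ∑ w : Word, lam w * Tfun U gN gP w = ∑ c ∈ U, (((gN c : GaussianInt)) - gP c) * testFn lam c := by
  unfold Tfun testFn
  calc ∑ w : Word, lam w * (∑ c ∈ U, (gN c : GaussianInt) * cellCoef c w - ∑ c ∈ U, (gP c : GaussianInt) * cellCoef c w)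
      = ∑ w : Word, ∑ c ∈ U, lam w * ((((gN c : GaussianInt)) - gP c) * cellCoef c w) := by
        refine Finset.sum_congr rfl fun w _ => ?_
        rw [← Finset.sum_sub_distrib, Finset.mul_sum]
        exact Finset.sum_congr rfl fun c _ => by ring
    _ = ∑ c ∈ U, ∑ w : Word, lam w * ((((gN c : GaussianInt)) - gP c) * cellCoef c w) := Finset.sum_comm
    _ = ∑ c ∈ U, (((gN c : GaussianInt)) - gP c) * ∑ w : Word, lam w * cellCoef c w := by
        refine Finset.sum_congr rfl fun c _ => ?_
        rw [Finset.mul_sum]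
        exact Finset.sum_congr rfl fun w _ => by ring

/-- the SIGNED TEST-FORM INEQUALITY in its bookkeeping form: if a real-valued cell function `ψ` is `≥ 0` on the N-support and `≤ 0` on the P-support,
the pairing `Σ (gN − gP)·ψ` is `≥ 0`, and it vanishes only if `ψ` vanishes on the whole support. -/
theorem signed_pairing_nonneg (U : Finset Cell) (gN gP : Cell → ℕ) (ψ : Cell → ℤ)
    (hN : ∀ c ∈ U, 0 < gN c → 0 ≤ ψ c) (hP : ∀ c ∈ U, 0 < gP c → ψ c ≤ 0) :
    0 ≤ ∑ c ∈ U, ((gN c : ℤ) - gP c) * ψ c ∧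
    (∑ c ∈ U, ((gN c : ℤ) - gP c) * ψ c = 0 → ∀ c ∈ U, 0 < gN c + gP c → ψ c = 0) := by
  have hterm : ∀ c ∈ U, 0 ≤ ((gN c : ℤ) - gP c) * ψ c := by
    intro c hc
    rcases Nat.eq_zero_or_pos (gN c) with h0 | hpos
    · rcases Nat.eq_zero_or_pos (gP c) with h0' | hpos'
      · simp [h0, h0']
      · have := hP c hc hpos'
        rw [h0]; push_cast; nlinarith
    · rcases Nat.eq_zero_or_pos (gP c) with h0' | hpos'
      · have := hN c hc hpos
        rw [h0']; push_cast; nlinarith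
      · have h1 := hN c hc hpos
        have h2 := hP c hc hpos'
        have : ψ c = 0 := le_antisymm h2 h1
        rw [this]; simp
  refine ⟨Finset.sum_nonneg hterm, fun hsum c hc hpos => ?_⟩
  have hc0 := (Finset.sum_eq_zero_iff_of_nonneg hterm).mp hsum c hc
  rcases Nat.eq_zero_or_pos (gN c) with h0 | hposN
  · have hposP : 0 < gP c := by omega
    rw [h0] at hc0
    have : (gP c : ℤ) * ψ c = 0 := by linear_combination -hc0
    rcases mul_eq_zero.mp this with h | h
    · exact absurd (by exact_mod_cast h) hposP.ne'
    · exact h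
  · rcases Nat.eq_zero_or_pos (gP c) with h0' | hposP
    · rw [h0'] at hc0
      have : (gN c : ℤ) * ψ c = 0 := by linear_combination hc0
      rcases mul_eq_zero.mp this with h | h
      · exact absurd (by exact_mod_cast h) hposN.ne'
      · exact h
    · exact le_antisymm (hP c hc hposP) (hN c hc hposN)

/-! ### §1.1 blind coweights: the SIGNED TEST-FORM LEMMA -/

/-- `λ` is BLIND (to the clean subspace, away from the two Bloch words): its e-free part has zero sum on every degree class. Mixed words are
unconstrained ((A1).1 kills them); `eeee`, `ēēēē` are read off separately. -/
def Blind (lam : Word → GaussianInt) : Prop :=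
  ∀ d : ℕ, ∑ w ∈ Finset.univ.filter (fun w : Word => w.efree ∧ w.deg = d), lam w = 0

theorem eeee_not_efree' : ¬ Word.eeee.efree := fun h => absurd (h 0) (by decide)
theorem EEEE_not_efree' : ¬ Word.EEEE.efree := fun h => absurd (h 0) (by decide)

theorem re_sum {ι : Type*} (s : Finset ι) (F : ι → GaussianInt) : (∑ i ∈ s, F i).re = ∑ i ∈ s, (F i).re := by
  classical
  refine Finset.induction_on s (by simp) ?_
  intro a s ha ih
  rw [Finset.sum_insert ha, Finset.sum_insert ha, Zsqrtd.re_add, ih]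

/-- for an (A1) assignment a blind coweight pairs to `λ(eeee)·μ + λ(ēēēē)·T(ēēēē)`. -/
theorem pairing_of_A1 {U : Finset Cell} {gN gP : Cell → ℕ} (h1 : A1fun U gN gP) {lam : Word → GaussianInt} (hb : Blind lam) :
    ∑ w : Word, lam w * Tfun U gN gP w = lam Word.eeee * mufun U gN gP + lam Word.EEEE * Tfun U gN gP Word.EEEE := by
  classical
  rw [← Finset.sum_filter_add_sum_filter_not Finset.univ (fun w : Word => w.efree)]
  -- e-free part vanishes degree by degree
  have hE : ∑ w ∈ Finset.univ.filter (fun w : Word => w.efree), lam w * Tfun U gN gP w = 0 := by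
    rw [← Finset.sum_fiberwise_of_maps_to (g := Word.deg) (t := Finset.univ.image Word.deg)
      (fun w _ => Finset.mem_image_of_mem _ (Finset.mem_univ w))]
    refine Finset.sum_eq_zero fun d _ => ?_
    rw [Finset.filter_filter]
    rcases ((Finset.univ.filter fun w : Word => w.efree ∧ w.deg = d)).eq_empty_or_nonempty with he | ⟨w₀, hw₀⟩
    · rw [he, Finset.sum_empty]
    · obtain ⟨hw₀e, hw₀d⟩ := (Finset.mem_filter.mp hw₀).2
      have hconst : ∀ w ∈ Finset.univ.filter (fun w : Word => w.efree ∧ w.deg = d), Tfun U gN gP w = Tfun U gN gP w₀ := fun w hw => by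
        obtain ⟨hwe, hwd⟩ := (Finset.mem_filter.mp hw).2
        exact h1.2 w w₀ hwe hw₀e (hwd.trans hw₀d.symm)
      rw [Finset.sum_congr rfl fun w hw => by rw [hconst w hw], ← Finset.sum_mul, hb d, zero_mul]
  -- mixed part: only the Bloch words survive (A1).1
  have hM : ∑ w ∈ Finset.univ.filter (fun w : Word => ¬ w.efree), lam w * Tfun U gN gP w =
      lam Word.eeee * mufun U gN gP + lam Word.EEEE * Tfun U gN gP Word.EEEE := by
    have hrw : ∀ w ∈ Finset.univ.filter (fun w : Word => ¬ w.efree), lam w * Tfun U gN gP w =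
        (if w = Word.eeee then lam Word.eeee * mufun U gN gP else 0) + (if w = Word.EEEE then lam Word.EEEE * Tfun U gN gP Word.EEEE else 0) := by
      intro w hw
      have hwe : ¬ w.efree := (Finset.mem_filter.mp hw).2
      by_cases he : w = Word.eeee
      · subst he
        have hne : Word.eeee ≠ Word.EEEE := by decide
        simp [hne, mufun]
      · by_cases hE : w = Word.EEEE
        · subst hE
          simp [he]
        · rw [if_neg he, if_neg hE, h1.1 w hwe he hE, mul_zero, add_zero]
    rw [Finset.sum_congr rfl hrw, Finset.sum_add_distrib, Finset.sum_ite_eq', Finset.sum_ite_eq']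
    have m1 : Word.eeee ∈ Finset.univ.filter (fun w : Word => ¬ w.efree) := Finset.mem_filter.mpr ⟨Finset.mem_univ _, eeee_not_efree'⟩
    have m2 : Word.EEEE ∈ Finset.univ.filter (fun w : Word => ¬ w.efree) :=
      Finset.mem_filter.mpr ⟨Finset.mem_univ _, EEEE_not_efree'⟩
    rw [if_pos m1, if_pos m2]
  rw [hE, hM, zero_add]

/-- **THE SIGNED TEST-FORM LEMMA.** For an (A1) assignment and a blind coweight `λ` with `λ(ēēēē) = 0`:
`λ(eeee)·μ = Σ_{c ∈ U} (gN c − gP c)·φ_λ(c)`; hence if `Re φ_λ ≥ 0` on the N-support and `≤ 0` on the P-support then `Re(λ(eeee)·μ) ≥ 0`, with equality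
only if `Re φ_λ` vanishes on the whole support. (`λ(eeee) = 0` and `Re φ_λ ≢ 0` on the support: contradiction — `λ` SEPARATES the coloured support;
`Re φ_λ ≡ 0`: MEMO-14's sign-blind `testForm_mu`.) -/
theorem signedTestForm {U : Finset Cell} {gN gP : Cell → ℕ} (h1 : A1fun U gN gP) {lam : Word → GaussianInt} (hb : Blind lam)
    (hE : lam Word.EEEE = 0) :
    lam Word.eeee * mufun U gN gP = ∑ c ∈ U, (((gN c : GaussianInt)) - gP c) * testFn lam c ∧
    ((∀ c ∈ U, 0 < gN c → 0 ≤ (testFn lam c).re) → (∀ c ∈ U, 0 < gP c → (testFn lam c).re ≤ 0) →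
      0 ≤ (lam Word.eeee * mufun U gN gP).re ∧
      ((lam Word.eeee * mufun U gN gP).re = 0 → ∀ c ∈ U, 0 < gN c + gP c → (testFn lam c).re = 0)) := by
  have hid : lam Word.eeee * mufun U gN gP = ∑ c ∈ U, (((gN c : GaussianInt)) - gP c) * testFn lam c := by
    rw [← pairing_eq_sum_testFn, pairing_of_A1 h1 hb, hE, zero_mul, add_zero]
  refine ⟨hid, fun hN hP => ?_⟩
  have hre : (lam Word.eeee * mufun U gN gP).re = ∑ c ∈ U, ((gN c : ℤ) - gP c) * (testFn lam c).re := by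
    rw [hid, re_sum]
    exact Finset.sum_congr rfl fun c _ => by simp [Zsqrtd.re_mul, sub_mul]
  rw [hre]
  exact signed_pairing_nonneg U gN gP (fun c => (testFn lam c).re) hN hP

/-- the SEPARATOR form: a blind `λ` with `λ(eeee) = λ(ēēēē) = 0`, `Re φ_λ ≥ 0` on the N-support, `≤ 0` on the P-support and `≠ 0` at one support cell
excludes every (A1) assignment with that support pattern. -/
theorem separator_excludes {U : Finset Cell} {gN gP : Cell → ℕ} (h1 : A1fun U gN gP) {lam : Word → GaussianInt} (hb : Blind lam)
    (he : lam Word.eeee = 0) (hE : lam Word.EEEE = 0)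
    (hN : ∀ c ∈ U, 0 < gN c → 0 ≤ (testFn lam c).re) (hP : ∀ c ∈ U, 0 < gP c → (testFn lam c).re ≤ 0) :
    ∀ c ∈ U, 0 < gN c + gP c → (testFn lam c).re = 0 :=
  ((signedTestForm h1 hb hE).2 hN hP).2 (by rw [he, zero_mul]; rfl)

/-! ### §1.2 the MARGINAL ROW SCHEMA (every level of the node's hierarchy)
A coweight whose pairing vanishes at every (A1) assignment (it lives on (A1).1-words: `OnA11`; or it is blind with both Bloch entries zero) and
whose test function FACTORS through a key map `κ : Cell → K` on `U` (`testFn λ c = F (κ c)`) yields the row `Σ_{k ∈ κ(U)} F k · (y_N[k] − y_P[k]) = 0`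
on the KEY MARGINALS `y[k] = Σ_{c ∈ U, κ c = k} g c` — valid at EVERY (A1) assignment, no symmetry of the assignment assumed. §7 of
`CoverIntegrality.lean` (LEVEL 1.5, |E| = 1 orbit rows on letter marginals) is the instance κ = (active letter, passive profile multiset); an |E| = 2
rung would be the instance κ = (charged letter pair, passive profile pair). The factorisation hypothesis is where each level's work sits. -/

/-- `λ` lives on the (A1).1-words: zero on every e-free word and on the two Bloch words. -/
def OnA11 (lam : Word → GaussianInt) : Prop :=
  (∀ w : Word, w.efree → lam w = 0) ∧ lam Word.eeee = 0 ∧ lam Word.EEEE = 0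

theorem pairing_eq_zero_of_OnA11 {U : Finset Cell} {gN gP : Cell → ℕ} (h1 : A1fun U gN gP) {lam : Word → GaussianInt} (h : OnA11 lam) :
    ∑ w : Word, lam w * Tfun U gN gP w = 0 := by
  refine Finset.sum_eq_zero fun w _ => ?_
  by_cases hw : w.efree
  · rw [h.1 w hw, zero_mul]
  · by_cases he : w = Word.eeee
    · rw [he, h.2.1, zero_mul]
    · by_cases hE : w = Word.EEEE
      · rw [hE, h.2.2, zero_mul]
      · rw [h1.1 w hw he hE, mul_zero]

theorem pairing_eq_zero_of_blind {U : Finset Cell} {gN gP : Cell → ℕ} (h1 : A1fun U gN gP) {lam : Word → GaussianInt} (hb : Blind lam)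
    (he : lam Word.eeee = 0) (hE : lam Word.EEEE = 0) : ∑ w : Word, lam w * Tfun U gN gP w = 0 := by
  rw [pairing_of_A1 h1 hb, he, hE, zero_mul, zero_mul, add_zero]

/-- the KEY MARGINAL of `g` at the key `k` under `κ`. -/
def marg {K : Type*} [DecidableEq K] (U : Finset Cell) (g : Cell → ℕ) (κ : Cell → K) (k : K) : ℕ :=
  ∑ c ∈ U.filter (fun c => κ c = k), g c

/-- fiberwise regrouping of a cell row whose coefficient factors through `κ`. -/
theorem row_regroup {K : Type*} [DecidableEq K] (U : Finset Cell) (gN gP : Cell → ℕ) (κ : Cell → K) (F : K → GaussianInt)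
    (ψ : Cell → GaussianInt) (hψ : ∀ c ∈ U, ψ c = F (κ c)) :
    ∑ c ∈ U, (((gN c : GaussianInt)) - gP c) * ψ c = ∑ k ∈ U.image κ, F k * (((marg U gN κ k : ℕ) : GaussianInt) - marg U gP κ k) := by
  rw [← Finset.sum_fiberwise_of_maps_to (s := U) (t := U.image κ) (g := κ) (fun c hc => Finset.mem_image_of_mem κ hc)]
  refine Finset.sum_congr rfl fun k _ => ?_
  unfold marg
  rw [Nat.cast_sum, Nat.cast_sum, ← Finset.sum_sub_distrib, Finset.mul_sum]
  refine Finset.sum_congr rfl fun c hc => ?_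
  obtain ⟨hcU, hck⟩ := Finset.mem_filter.mp hc
  rw [hψ c hcU, hck]; ring

/-- **MARGINAL ROW SCHEMA, (A1).1 form:** a coweight on (A1).1-words with key-factorising test function gives a valid row on the key marginals. -/
theorem marginalRow_sound {K : Type*} [DecidableEq K] {U : Finset Cell} {gN gP : Cell → ℕ} (h1 : A1fun U gN gP)
    {lam : Word → GaussianInt} (hl : OnA11 lam) (κ : Cell → K) (F : K → GaussianInt) (hF : ∀ c ∈ U, testFn lam c = F (κ c)) :
    ∑ k ∈ U.image κ, F k * (((marg U gN κ k : ℕ) : GaussianInt) - marg U gP κ k) = 0 := by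
  rw [← row_regroup U gN gP κ F (testFn lam) hF, ← pairing_eq_sum_testFn, pairing_eq_zero_of_OnA11 h1 hl]

/-- **MARGINAL ROW SCHEMA, blind form** (covers the e-free degree-difference rows = the class rows as well). -/
theorem marginalRow_sound_blind {K : Type*} [DecidableEq K] {U : Finset Cell} {gN gP : Cell → ℕ} (h1 : A1fun U gN gP)
    {lam : Word → GaussianInt} (hb : Blind lam) (he : lam Word.eeee = 0) (hE : lam Word.EEEE = 0)
    (κ : Cell → K) (F : K → GaussianInt) (hF : ∀ c ∈ U, testFn lam c = F (κ c)) :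
    ∑ k ∈ U.image κ, F k * (((marg U gN κ k : ℕ) : GaussianInt) - marg U gP κ k) = 0 := by
  rw [← row_regroup U gN gP κ F (testFn lam) hF, ← pairing_eq_sum_testFn, pairing_eq_zero_of_blind h1 hb he hE]

/-- the INTEGRALITY side of a key marginal: a present cell makes its key marginal `≥ 1`, and the marginals add up to the copy count on `U`. -/
theorem one_le_marg_of_pos {K : Type*} [DecidableEq K] {U : Finset Cell} {g : Cell → ℕ} (κ : Cell → K) {c : Cell} (hc : c ∈ U)
    (hg : 0 < g c) : 1 ≤ marg U g κ (κ c) := by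
  unfold marg
  exact le_trans hg (Finset.single_le_sum (f := g) (fun _ _ => Nat.zero_le _) (Finset.mem_filter.mpr ⟨hc, rfl⟩))

theorem sum_marg_eq {K : Type*} [DecidableEq K] (U : Finset Cell) (g : Cell → ℕ) (κ : Cell → K) :
    ∑ k ∈ U.image κ, marg U g κ k = ∑ c ∈ U, g c := by
  unfold marg
  exact Finset.sum_fiberwise_of_maps_to (s := U) (t := U.image κ) (g := κ) (fun c hc => Finset.mem_image_of_mem κ hc) _

/-! ## §2 profile-pure cells and the TWO-RING LAW -/

/-- the word `h h h h` (degree 4). -/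
def wHHHH : Word := ![Sym.h, Sym.h, Sym.h, Sym.h]
/-- the word `pt h h 1` (degree 4). -/
def wPTHH : Word := ![Sym.pt, Sym.h, Sym.h, Sym.one]

theorem wHHHH_efree : wHHHH.efree := by intro f; fin_cases f <;> rfl
theorem wPTHH_efree : wPTHH.efree := by intro f; fin_cases f <;> rfl
theorem wHHHH_deg : wHHHH.deg = 4 := by decide
theorem wPTHH_deg : wPTHH.deg = 4 := by decide

/-- a cell is PROFILE-PURE of profile `(α, ν)`: every letter has level `α` and self-intersection `ν`. -/
def Pure (α ν : ℤ) (c : Cell) : Prop := ∀ f : Fin 4, (c f).a = α ∧ (c f).selfInt = ν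

theorem cellCoef_pure {α ν : ℤ} {c : Cell} (hc : Pure α ν c) :
    cellCoef c wHH = (α : GaussianInt) ^ 2 ∧ cellCoef c wPT = (ν : GaussianInt) ∧
    cellCoef c wHHHH = (α : GaussianInt) ^ 4 ∧ cellCoef c wPTHH = (ν : GaussianInt) * (α : GaussianInt) ^ 2 := by
  obtain ⟨h0a, h0n⟩ := hc 0
  obtain ⟨h1a, _⟩ := hc 1
  obtain ⟨h2a, _⟩ := hc 2
  obtain ⟨h3a, _⟩ := hc 3
  refine ⟨?_, ?_, ?_, ?_⟩
  · rw [cellCoef_wHH, h0a, h1a]; ring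
  · rw [cellCoef_wPT, h0n]
  · unfold cellCoef wHHHH
    simp [Fin.prod_univ_four, Sym.coef, h0a, h1a, h2a, h3a]; ring
  · unfold cellCoef wPTHH
    simp [Fin.prod_univ_four, Sym.coef, h0n, h1a, h2a]; ring

/-- evaluating one side of a row on a profile-pure support. -/
theorem sum_eval {U : Finset Cell} {g : Cell → ℕ} {w : Word} {v : GaussianInt} (hw : ∀ c ∈ U, 0 < g c → cellCoef c w = v) :
    ∑ c ∈ U, (g c : GaussianInt) * cellCoef c w = v * ∑ c ∈ U, (g c : GaussianInt) := by
  rw [Finset.mul_sum]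
  refine Finset.sum_congr rfl fun c hc => ?_
  rcases Nat.eq_zero_or_pos (g c) with h0 | hpos
  · simp [h0]
  · rw [hw c hc hpos]; ring

/-- **TWO-RING LAW.** An (A1) assignment on any finite cell set whose N-support is profile-pure of profile `(aN, nN)` and whose P-support is profile-pure
of profile `(aP, nP)`, with `aN² ≠ aP²` and `aP² ≠ nP` (`b_P ≠ 0`), has EMPTY P-side; if also `aN² ≠ nN` (`b_N ≠ 0`) its N-side is empty. Only (A1).2 on
the two degree-2 and the two degree-4 e-free words `hh11 ∕ pt111`, `hhhh ∕ pt h h 1` is used. -/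
theorem twoRing_law {U : Finset Cell} {gN gP : Cell → ℕ} (h1 : A1fun U gN gP) {aN nN aP nP : ℤ}
    (hN : ∀ c ∈ U, 0 < gN c → Pure aN nN c) (hP : ∀ c ∈ U, 0 < gP c → Pure aP nP c)
    (ha : aN ^ 2 ≠ aP ^ 2) (hbP : aP ^ 2 ≠ nP) :
    (∀ c ∈ U, gP c = 0) ∧ (aN ^ 2 ≠ nN → ∀ c ∈ U, gN c = 0) := by
  have E2 := h1.2 wHH wPT wHH_efree wPT_efree (wHH_deg.trans wPT_deg.symm)
  have E4 := h1.2 wHHHH wPTHH wHHHH_efree wPTHH_efree (wHHHH_deg.trans wPTHH_deg.symm)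
  unfold Tfun at E2 E4
  rw [sum_eval (fun c hc hpos => (cellCoef_pure (hN c hc hpos)).1), sum_eval (fun c hc hpos => (cellCoef_pure (hP c hc hpos)).1),
    sum_eval (fun c hc hpos => (cellCoef_pure (hN c hc hpos)).2.1), sum_eval (fun c hc hpos => (cellCoef_pure (hP c hc hpos)).2.1)] at E2
  rw [sum_eval (fun c hc hpos => (cellCoef_pure (hN c hc hpos)).2.2.1), sum_eval (fun c hc hpos => (cellCoef_pure (hP c hc hpos)).2.2.1),
    sum_eval (fun c hc hpos => (cellCoef_pure (hN c hc hpos)).2.2.2), sum_eval (fun c hc hpos => (cellCoef_pure (hP c hc hpos)).2.2.2)] at E4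
  set SN := ∑ c ∈ U, (gN c : GaussianInt) with hSN
  set SP := ∑ c ∈ U, (gP c : GaussianInt) with hSP
  -- (aN² − aP²)·b_P·ΣP = 0
  have key : (((aN ^ 2 - aP ^ 2) * (aP ^ 2 - nP) : ℤ) : GaussianInt) * SP = 0 := by
    push_cast
    linear_combination E4 - ((aN : GaussianInt) ^ 2) * E2
  have hSP0 : SP = 0 := by
    rcases mul_eq_zero.mp key with h | h
    · exact absurd (Int.cast_eq_zero.mp h) (mul_ne_zero (sub_ne_zero.mpr ha) (sub_ne_zero.mpr hbP))
    · exact h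
  have hPzero : ∀ c ∈ U, gP c = 0 := by
    have : ((∑ c ∈ U, gP c : ℕ) : GaussianInt) = 0 := by rw [Nat.cast_sum]; exact hSP0
    exact fun c hc => (Finset.sum_eq_zero_iff.mp (Nat.cast_eq_zero.mp this)) c hc
  refine ⟨hPzero, fun hbN => ?_⟩
  -- with ΣP = 0, degree 2 gives b_N·ΣN = 0
  have key2 : (((aN ^ 2 - nN) : ℤ) : GaussianInt) * SN = 0 := by
    push_cast
    linear_combination E2 + ((aP : GaussianInt) ^ 2 - nP) * hSP0
  have hSN0 : SN = 0 := by
    rcases mul_eq_zero.mp key2 with h | h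
    · exact absurd (Int.cast_eq_zero.mp h) (sub_ne_zero.mpr hbN)
    · exact h
  have : ((∑ c ∈ U, gN c : ℕ) : GaussianInt) = 0 := by rw [Nat.cast_sum]; exact hSN0
  exact fun c hc => (Finset.sum_eq_zero_iff.mp (Nat.cast_eq_zero.mp this)) c hc

/-- **TWO-RING LAW, design form**: a list design supported in a finite `S` whose N- and P-support cells are profile-pure of two profiles as above, and which
is (A1)-clean, has no support at all (hence `μ = 0`, rank `0`, copies `0`). -/
theorem twoRing_design {D : Design} {S : Finset Cell} (hS : SuppIn D S) (h1 : D.A1) {aN nN aP nP : ℤ}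
    (hN : ∀ c ∈ D.suppN, Pure aN nN c) (hP : ∀ c ∈ D.suppP, Pure aP nP c)
    (ha : aN ^ 2 ≠ aP ^ 2) (hbP : aP ^ 2 ≠ nP) (hbN : aN ^ 2 ≠ nN) :
    D.suppN = [] ∧ D.suppP = [] := by
  have h1f : A1fun S D.mN D.mP := by
    refine ⟨fun w hw he hE => ?_, fun w w' hw hw' hd => ?_⟩
    · have := h1.1 w hw he hE
      rwa [T_eq_sum hS] at this
    · have := h1.2 w w' hw hw' hd
      rwa [T_eq_sum hS, T_eq_sum hS] at this
  obtain ⟨hP0, hN0⟩ := twoRing_law h1f (fun c _ hpos => hN c ((mem_suppN_iff_pos D c).mpr hpos))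
    (fun c _ hpos => hP c ((mem_suppP_iff_pos D c).mpr hpos)) ha hbP
  have hN0 := hN0 hbN
  constructor
  · rcases hq : D.suppN with _ | ⟨c, t⟩
    · rfl
    · exfalso
      have hc : c ∈ D.suppN := by rw [hq]; exact List.mem_cons_self
      have hpos := (mem_suppN_iff_pos D c).mp hc
      have hcS : c ∈ S := hS c (List.mem_append.mpr (Or.inl hc))
      exact absurd (hN0 c hcS) hpos.ne'
  · rcases hq : D.suppP with _ | ⟨c, t⟩
    · rfl
    · exfalso
      have hc : c ∈ D.suppP := by rw [hq]; exact List.mem_cons_self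
      have hpos := (mem_suppP_iff_pos D c).mp hc
      have hcS : c ∈ S := hS c (List.mem_append.mpr (Or.inr hc))
      exact absurd (hP0 c hcS) hpos.ne'

/-! ### §2.1 the two instances of record (MEMO-14 §4 synthesis-triple supports, height 14) -/

/-- Pythagorean ring `(7; ±3, ±4), (7; ±4, ±3)`: profile `(7, 24)`; companions `(4; ±5, ±5)`: profile `(4, −34)`. -/
theorem pure_pythagorean_N (c : Cell) (hc : ∀ f, (c f).a = 7 ∧ (c f).x ^ 2 + (c f).y ^ 2 = 25) : Pure 7 24 c := fun f => by
  obtain ⟨ha, hb⟩ := hc f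
  refine ⟨ha, ?_⟩
  unfold Letter.selfInt Letter.bnorm; rw [ha, hb]; norm_num

theorem pure_pythagorean_P (c : Cell) (hc : ∀ f, (c f).a = 4 ∧ (c f).x ^ 2 + (c f).y ^ 2 = 50) : Pure 4 (-34) c := fun f => by
  obtain ⟨ha, hb⟩ := hc f
  refine ⟨ha, ?_⟩
  unfold Letter.selfInt Letter.bnorm; rw [ha, hb]; norm_num

/-- **no non-zero non-negative (A1) assignment lives on the Pythagorean synthesis-triple support** (any finite `U`; N-support inside the `(7;·)`-letters with
`x² + y² = 25`, P-support inside the `(4;·)`-letters with `x² + y² = 50`). -/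
theorem twoRing_pythagorean {U : Finset Cell} {gN gP : Cell → ℕ} (h1 : A1fun U gN gP)
    (hN : ∀ c ∈ U, 0 < gN c → ∀ f, (c f).a = 7 ∧ (c f).x ^ 2 + (c f).y ^ 2 = 25)
    (hP : ∀ c ∈ U, 0 < gP c → ∀ f, (c f).a = 4 ∧ (c f).x ^ 2 + (c f).y ^ 2 = 50) :
    ∀ c ∈ U, gN c = 0 ∧ gP c = 0 := by
  obtain ⟨hP0, hN0⟩ := twoRing_law h1 (fun c hc hpos => pure_pythagorean_N c (hN c hc hpos))
    (fun c hc hpos => pure_pythagorean_P c (hP c hc hpos)) (by norm_num) (by norm_num)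
  exact fun c hc => ⟨hN0 (by norm_num) c hc, hP0 c hc⟩

/-- hub-neighbour ring `(13; ±1, 0), (13; 0, ±1)`: profile `(13, 168)`; companions `(10; ±2, ±2)`: profile `(10, 92)`. -/
theorem twoRing_hub {U : Finset Cell} {gN gP : Cell → ℕ} (h1 : A1fun U gN gP)
    (hN : ∀ c ∈ U, 0 < gN c → ∀ f, (c f).a = 13 ∧ (c f).x ^ 2 + (c f).y ^ 2 = 1)
    (hP : ∀ c ∈ U, 0 < gP c → ∀ f, (c f).a = 10 ∧ (c f).x ^ 2 + (c f).y ^ 2 = 8) :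
    ∀ c ∈ U, gN c = 0 ∧ gP c = 0 := by
  have pN : ∀ c ∈ U, 0 < gN c → Pure 13 168 c := fun c hc hpos f => by
    obtain ⟨ha, hb⟩ := hN c hc hpos f
    refine ⟨ha, ?_⟩
    unfold Letter.selfInt Letter.bnorm; rw [ha, hb]; norm_num
  have pP : ∀ c ∈ U, 0 < gP c → Pure 10 92 c := fun c hc hpos f => by
    obtain ⟨ha, hb⟩ := hP c hc hpos f
    refine ⟨ha, ?_⟩
    unfold Letter.selfInt Letter.bnorm; rw [ha, hb]; norm_num
  obtain ⟨hP0, hN0⟩ := twoRing_law h1 pN pP (by norm_num) (by norm_num)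
  exact fun c hc => ⟨hN0 (by norm_num) c hc, hP0 c hc⟩

end Summit.HodgeConjecture.HodgeConjecture.Cruxes.BlochSeedDiscOne.SignedTestForms
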